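import Summits.BirchSwinnertonDyer.BirchSwinnertonDyer.Theorems.ErratumRoadFiveEulerHalfRamTwistOfPotMult
import Summits.BirchSwinnertonDyer.Rank1Residual.Partition.Rows
import HarnessLib

/-!
# The SERVED-CLASS target `EulerHalfPOnlyMultPotMultTwinAtFive` BY NAME (Defs file; crux
# stmt-BirchSwinnertonDyer-19715, idea `ramified-twin-ram-transport`; plan g43 RULING 79 (i) / GO 20:41:59Z)

The closed `Prop` constant the planner can item-state (ER5 support item, rank 9): the crux's S1b clause —
class X11b at `p ≥ 5`, `ρ̄_{E,p}` onto, no (ram) prime, `p ∣ ∏c`, `p` the ONLY multiplicative prime,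
split at `p` with `p ∣ ord_p Δ_min` (the registered text of `Birth.Statement.res_pOnlyMultCarrierAtFive`) —
with ONE more hypothesis, a SERVED additive prime: an odd `q` with `Addv W q`, `Additive.PotMult W q`
(`ord_q j < 0`) and `p ∤ ord_q j`; conclusion the Euler-system half `Typed.MissingUpperBoundAt W p`.
This is the LEAD g7 SPEC `PotMultTwinTargetSpec.lean` (evidence bbb507f02f0120c2 on the crux item)
VERBATIM as to the definition; per the cell convention (RULING 75) the closed constant is tagged
`@[conjecture]` — it is OPEN (the road `ramified-twin-ram-transport` reaches it modulo print + the genus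
Kolyvagin leaves + one Jetchev port; TURNKEY §8 of the LEAD memo); NOTHING is asserted.

The kernel check that the target is a SUB-STATEMENT of the crux (`eulerHalfPOnlyMultPotMultTwinAtFive_of_crux`:
a pair whose only multiplicative prime is `p` has no even inert set `S ∋ p`) lives in the companion file
`Theorems/ErratumRoadFiveEulerHalfPotMultTwinOfCrux.lean`, NOT here: this Defs module must stay
importable from `Theses/ErratumRoadFive.lean` (the planner's item imports it), so it does not import the
route file. No summit statement is touched; BSD is proved for no curve.
-/

set_option autoImplicit false
-- D-0017: single-problem summit, so `Summit.BirchSwinnertonDyer.BirchSwinnertonDyer.…` repeats a namespace BY DESIGN.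
set_option linter.dupNamespace false

noncomputable section

open scoped Classical

open WeierstrassCurve Literature.NumberTheory.EllipticCurves
  Literature.NumberTheory.EllipticCurves.Rank1Residual
  Literature.NumberTheory.EllipticCurves.Rank1Residual.Typed
  Summit.BirchSwinnertonDyer.Rank1Residual

namespace Summit.BirchSwinnertonDyer.BirchSwinnertonDyer.Theorems.EulerHalfPotMultTwin

/-- **The served-class target `EulerHalfPOnlyMultPotMultTwinAtFive`** (LEAD g7 spec for the idea
`ramified-twin-ram-transport`, crux stmt-BirchSwinnertonDyer-19715): on class X11b at `p ≥ 5` with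
`ρ̄_{E,p}` onto, no (ram) prime, `p ∣ ∏c`, `p` the ONLY multiplicative prime, split at `p` with
`p ∣ ord_p Δ_min` (the crux's S1b clause verbatim), AND an odd additive potentially multiplicative
prime `q` with `p ∤ ord_q j(E)`: the Euler-system half `Typed.MissingUpperBoundAt W p`. A `Prop`
constant; OPEN; nothing asserted. [cite: Castella2018Erratum, Thm. 2.3 (hypothesis (ram) — the served class
is exactly where it FAILS; shape of the missing half only)] -/
@[conjecture]
def EulerHalfPOnlyMultPotMultTwinAtFive : Prop :=
  ∀ (W : WeierstrassCurve ℚ) [W.IsElliptic] [W.IsGloballyMinimal] (p : ℕ) [Fact p.Prime],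
    ClassX11b W p → 5 ≤ p → Surj W p → ¬ Ram W p → p ∣ W.tamagawaProduct →
    (∀ (ℓ : ℕ) [Fact ℓ.Prime], W.HasMultiplicativeReductionAtPrime ℓ → ℓ = p) →
    W.HasSplitMultiplicativeReductionAtPrime p → p ∣ padicValInt p W.minimalDiscriminantInt →
    (∃ q : ℕ, ∃ _ : Fact q.Prime, q ≠ 2 ∧ Addv W q ∧ Additive.PotMult W q ∧
      ¬ (p : ℤ) ∣ padicValRat q W.j) →
    MissingUpperBoundAt W p

end Summit.BirchSwinnertonDyer.BirchSwinnertonDyer.Theorems.EulerHalfPotMultTwin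

end
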